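import Summits.BirchSwinnertonDyer.BirchSwinnertonDyer.Theorems.QuadraticBranchSignedControlPlusEtaReverseTransport
import Summits.BirchSwinnertonDyer.BirchSwinnertonDyer.Theorems.QuadraticBranchSignedControlPlusEtaLowerInclusionRankZeroPairs
import Summits.BirchSwinnertonDyer.BirchSwinnertonDyer.Theorems.QuadraticBranchSignedControlEtaTransportCharacter
import Summits.BirchSwinnertonDyer.Rank1Residual.Additive.QuadraticTwistTypeG
import Summits.BirchSwinnertonDyer.Rank1Residual.Additive.CyclotomicQuadraticSubfield
import HarnessLib

/-!
# Route `QuadraticBranchSignedControl` (rung K8, cell `bsd-potss`), crux `PlusEtaLowerInclusion`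
# (stmt-BirchSwinnertonDyer-19601): THE CONVERSE ROAD IN MILLER'S CURRENCY — Kobayashi's Eisenstein
# inclusion at `η` for the good supersingular twin `V` FROM the LOWER half of `BSD_p(W)`
# (`ord_p #Ш(W)_an ≤ ord_p #Ш(W)`, analytic rank `0`) on ALL tower-onto rank-`0` rows, Tamagawa-defect
# rows included (seat `bsd-potss-ctrl` g4)

WHAT. Seat k8-rung's p459681 (`…PlusEtaLowerInclusionRankZeroPairs`) proves (E⁺_η)(V) at a tower-onto
Gss2 pair with `L(W,1) ≠ 0` from the Selmer-shape witness «`L(W,1)/Ω_W = q`, `v_p(q) ≤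
ord_p #Sel_{p^∞}(W/ℚ)`» (resp. `≤ ord_p #Ш(W)[p^∞]`), using ctrl g2's MC-free INEQUALITY
`ord_p #Sel ≤ v_p(g(0))`. On a row with `p ∣ Tam(W)` that witness is FALSE whenever BSD holds
(`v_p(q) = ord_p #Ш + ord_p Tam(W)` there, `p ∤ #W(ℚ)_tors`): of the 19 rank-`0` tower-onto residue
rows of 19601 (census j255146, seat k8eta-c1) FIVE are such rows (168150g1, 231650m1, 248550l1,
321450n1 with `ord₅ Tam = 2`; 288600bn1 with `ord₅ Tam = 1`, `ord₅ #Ш_an = 2`). THIS FILE runs the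
cell's T-e2-r0 chain backwards through the EXACT even control instead (tool file
`…PlusEtaReverseTransport`: (D5⁺)⁻¹ + B. D. Kim's formula without the main conjecture,
`ord_p #Sel + ord_p(Tam/#tors²) = v_p(g(0))`, Poitou–Tate `hPT`), so that the input is exactly the
tree's lower-half currency `Typed.MissingLowerBoundAt W p` (or Miller's `BSDp W p`), Tamagawa numbers
and all — every rank-`0` row:
* `padicValRat_le_selmer_of_missingLowerBoundAt_rankZero` — Miller's currency ⟹ the Selmer side
  (`v_p(L(W,1)/Ω_W) ≤ ord_p #Sel_{p^∞}(W/ℚ) + ord_p(Tam(W)/#W(ℚ)_tors²)`; converse of ctrl g2's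
  `EvenControlZero.missingLowerBoundAt_rankZero_of_selmer_le`; GZK for finiteness).
* **`quadraticBranchPlusEtaLowerInclusionAt_of_selmer_le`** (core: the Kato-side inclusion at `η`
  DISPLAYED in the node's binders, the Selmer-side inequality with the Tamagawa term displayed) /
  **`…_of_missingLowerBoundAt`** (`Typed.MissingLowerBoundAt W p` + GZK) /
  **`…_of_missingLowerBoundAt_of_surjective`** (tower onto: the Kato side is Kobayashi's Thm. 4.1 at
  `η` with `n = 0`) / `…_of_bsdp_of_surjective` (`BSDp W p` + `r_an(W) = 0`) ⟹
  `QuadraticBranchPlusEtaLowerInclusionAt V p`; and `quadraticBranchPlusEtaMainConjectureAt_of_…` —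
  Kobayashi's even main conjecture at `η` in full at the pair.
* `…_of_shaAn_nonpos_of_surjective` — rows with `v_p(#Ш(W)_an) ≤ 0`: `MissingLowerBoundAt` is trivial.
PROOF. For an `η`-datum `D'` over an abstract `K₀ = ℚ(μ_p)`: `θ² = p*` in `K₀` (Gauss), the crux's
abstract `ηq` IS the sign character of `θ` (k8q-c3's `eta_eq_one_iff_smul_rootInClosure`); (D5⁺)⁻¹
reads `D'` as a plus dual datum `D` of `W` with the same module; `Char = (g)` (principal, `Λ` a UFD);
the Kato side gives `g ∣ Lη`; the value identity (`valuation_constantCoeff_eq_padicValRat_of_twist`)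
gives `Lη(0) ≠ 0` and `v_p(Lη(0)) = v_p(L(W,1)/Ω_W)`; the exact formula gives `v_p(g(0)) =
ord_p #Sel + ord_p(Tam/#tors²) ≥ v_p(Lη(0))`; k8-rung's `Λ`-squeeze
`span_singleton_eq_of_dvd_of_valuation_le` gives `(g) = (Lη)`.

HONEST FRAMING (cell `bsd-potss`, run/shared/lean/pub/bsd-potss/; FULL-BSD rank ≤ 1 programme,
tranche 1b, HUMAN RULING D-0036/D-0074): THEOREMS ONLY — no definition, no named Literature fact, no
Summits-side `def … : Prop`, no `sorry`, axioms standard. Every statement is CONDITIONAL on inputs in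
hypothesis position: Poitou–Tate duality for Selmer structures (`poitouTate_selmerStructure_duality_real ℚ`
— the price of the Tamagawa-defect rows), modularity (`hasEntireLFunction_rat`), GZK
(`rank_eq_analyticRank_of_analyticRank_le_one`), Kobayashi 2003 Thm. 2.2 / Thm. 4.1 at `η`,
Kitajima–Otsuki 2018 Main Thm. 1.3 at `η` (named facts — NOT proved in the tree) and, per pair, the
LOWER half of `BSD_p(W)` — an INPUT (per row: a unit Kurihara number through Kim's theorem, or
descent), never a claim. Rows with `L(W,1) = 0` are not touched. The crux 19601 is OPEN class-wide and
is NOT closed; nothing is booked; no label / mark / count of `RESIDUAL-MAP.md` moves; `BSD(W, p)` is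
claimed for no pair. `--supports stmt-BirchSwinnertonDyer-19601`.

References: [Kobayashi2003] Thm. 2.2 (p. 5), §3 + (3.4)/(3.6) (pp. 5–7), §4 Even main conjecture +
Thm. 4.1 (p. 8), Thm. 9.3 with (9.33) (pp. 26–27); [BDKim2013] Thm. 1.1 (shape); [GreenbergLNM1716]
§1 (pp. 54, 60), §4; [KitajimaOtsuki2018] Main Thm. 1.3; [Kato2004Asterisque] Thm. 12.5 (shape);
[Miller2011LMS] §1, Def. 1.1; [Wuthrich2014] Prop. 21 (shape of the bookkeeping); [Washington1997]
§13.2; [Kim2026] Thm. 1.8 (6) (source of the per-row input only).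
-/

set_option autoImplicit false
set_option linter.dupNamespace false

noncomputable section

open scoped Classical

open CongruenceSubgroup Field Function NumberField IsDedekindDomain WeierstrassCurve
open Literature.NumberTheory.EllipticCurves
open Literature.NumberTheory.EllipticCurves.ModularForms
open Literature.NumberTheory.EllipticCurves.Rank1Residual
open Literature.NumberTheory.EllipticCurves.Rank1Residual.Typed
open Literature.NumberTheory.GaloisRepresentations
open Literature.NumberTheory.GaloisCohomology
open Literature.NumberTheory.EllipticCurves.IwasawaAlgebra
open Literature.NumberTheory.EllipticCurves.IwasawaDual ZpExtension
open Summit.BirchSwinnertonDyer.Rank1Residual.X11b.Levels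
open Summit.BirchSwinnertonDyer.Rank1Residual.X11b
open Summit.BirchSwinnertonDyer.Rank1Residual.Additive
open Summit.BirchSwinnertonDyer.Rank1Residual.Additive.SignedTwist
open scoped ContRepresentation
open Summit.BirchSwinnertonDyer.Rank1Residual.AdditivePotMult

namespace Summit.BirchSwinnertonDyer.BirchSwinnertonDyer.Theorems

namespace ConverseControl

/-! ## §3 The converse road: the LOWER half of `BSD_p(W)` in analytic rank `0` gives (E⁺_η)(V) -/

section Converse

variable (W : WeierstrassCurve ℚ) [W.IsElliptic] [W.IsGloballyMinimal] (p : ℕ) [hp : Fact p.Prime]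

/-- **Rank-`0` bookkeeping REVERSED (Miller's currency ⟹ the Selmer side).** If `L(W,1) ≠ 0`,
`L(W,1)/Ω_W = q ∈ ℚ` and `ord_p #Ш(W)_an ≤ ord_p #Ш(W)` (`Typed.MissingLowerBoundAt W p`), then
`v_p(q) ≤ ord_p #Sel_{p^∞}(W/ℚ) + ord_p(Tam(W)/#W(ℚ)_tors²)`: GZK gives `rank W(ℚ) = 0` and `Ш(W)`
finite, `#Ш_an = q·#W(ℚ)_tors²/Tam(W)` (`Wuthrich2014.shaAn_eq_of_L_one_div_eq`),
`ord_p #Ш = ord_p #Ш[p^∞] = ord_p #Sel_{p^∞}(W/ℚ)` (`natCard_selmerGroupPInfty_eq_natCard_primaryComponent_sha`).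
The converse of the cell's `EvenControlZero.missingLowerBoundAt_rankZero_of_selmer_le`.
[cite: Miller2011LMS, §1 and Def. 1.1] [cite: GreenbergLNM1716, §1 p. 54 and §4 p. 103] -/
theorem padicValRat_le_selmer_of_missingLowerBoundAt_rankZero
    (hGZK : rank_eq_analyticRank_of_analyticRank_le_one) (hL : W.entireLFunction 1 ≠ 0) {q : ℚ}
    (hq : W.entireLFunction 1 / (W.realPeriodRat : ℂ) = (q : ℂ)) (hlow : MissingLowerBoundAt W p) :
    padicValRat p q ≤ (padicValNat p (Nat.card ↥(W.selmerGroupPInfty p)) : ℤ) +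
      padicValRat p ((W.tamagawaProduct : ℚ) / (W.torsionOrder : ℚ) ^ 2) := by
  obtain ⟨hmw0, hE, hfin, hshaAn⟩ := Wuthrich2014.shaAn_eq_of_L_one_div_eq hGZK W hL hq
  haveI := hE
  haveI := hfin
  obtain ⟨s, hs, hsle⟩ := hlow
  have hΩ : (W.realPeriodRat : ℂ) ≠ 0 := by exact_mod_cast W.realPeriodRat_pos_holds.ne'
  have hq0 : q ≠ 0 := by
    rintro rfl
    apply hL
    have h := hq
    rw [Rat.cast_zero, div_eq_zero_iff] at h
    exact h.resolve_right hΩ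
  have hT0 : W.torsionOrder ≠ 0 := W.torsionOrder_pos_holds.ne'
  have hTq : (W.torsionOrder : ℚ) ≠ 0 := by exact_mod_cast hT0
  have hPq : (W.tamagawaProduct : ℚ) ≠ 0 := by exact_mod_cast W.tamagawaProduct_pos_holds.ne'
  have hcardT : (Nat.card W.toAffine.Point : ℚ) = (W.torsionOrder : ℚ) := by
    rw [W.torsionOrder_eq_natCard_of_finite]
  -- the witness `s` IS `q·#tors²/Tam`
  have hsq : s = q * (Nat.card W.toAffine.Point : ℚ) ^ 2 / (W.tamagawaProduct : ℚ) := by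
    have h : ((s : ℚ) : ℂ) = ((q * (Nat.card W.toAffine.Point : ℚ) ^ 2 / (W.tamagawaProduct : ℚ) : ℚ) : ℂ) :=
      hs.symm.trans hshaAn
    exact_mod_cast h
  rw [hsq, hcardT, padicValRat.div (mul_ne_zero hq0 (pow_ne_zero 2 hTq)) hPq,
    padicValRat.mul hq0 (pow_ne_zero 2 hTq), padicValRat.pow] at hsle
  rw [padicValRat.div hPq (pow_ne_zero 2 hTq), padicValRat.pow]
  -- `#Sel_{p^∞} = #Ш[p^∞]`, `ord_p #Ш[p^∞] = ord_p #Ш`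
  have hSel := W.natCard_selmerGroupPInfty_eq_natCard_primaryComponent_sha p
  have hSha : padicValNat p (Nat.card (AddCommGroup.primaryComponent W.sha p)) =
      padicValNat p W.shaOrder := by
    rw [WeierstrassCurve.shaOrder, padicValNat_card_addPrimaryComponent]
  rw [hSel, hSha]
  linarith

/-- **THE CONVERSE ROAD — (E⁺_η)(V) from a Selmer-side inequality for `W` (core form).** `W` globally
minimal, `p ≥ 5`, `V` a globally minimal model of `W^{(p*)}` (`C • W.quadraticTwist((−1)^{p/2} p) = V`)
good at `p` with `a_p(V) = 0`, `L(W,1) ≠ 0`. INPUTS (all displayed, hypothesis position): Poitou–Tate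
duality `hPT`, modularity `hmod`, Kobayashi's Thm. 2.2 at `η` (`h22`, finiteness / torsion of
`X⁺(V/K_∞)^η`), Kitajima–Otsuki's Main Thm. 1.3 at `η` (`hKO`, no finite submodule), the KATO-SIDE
inclusion `(L_p⁺(V,η,X)) ⊆ Char(X⁺(V/K_∞)^η)` in the node's binders (`hup`; on the tower-onto locus =
Kobayashi's Thm. 4.1 with `n = 0`, see the next theorem), and the Selmer-side inequality
`hle : v_p(L(W,1)/Ω_W) ≤ ord_p #Sel_{p^∞}(W/ℚ) + ord_p(Tam(W)/#W(ℚ)_tors²)` (= the LOWER half of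
`BSD_p(W)`, previous theorem). CONCLUSION: Kobayashi's Eisenstein inclusion at `η`,
`Char(X⁺(V/K_∞)^η) ⊆ (L_p⁺(V, η, X))` for EVERY `η`-datum (`QuadraticBranchPlusEtaLowerInclusionAt V p`).
PROOF (the cell's T-e2-r0 control chain run BACKWARDS): for an `η`-datum `D'` over an abstract
`K₀ = ℚ(μ_p)` pick `θ² = p*` in `K₀` (Gauss) — the crux's abstract `ηq` IS the sign character of `θ`
(`eta_eq_one_iff_smul_rootInClosure`); (D5⁺)⁻¹ (§1) reads `D'` as a plus dual datum `D` of `W` over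
`ℚ_∞` with the same module; `Char = (g)` is principal (`Λ` a UFD); `hup` gives `g ∣ Lη`, the value
identity gives `Lη(0) ≠ 0`, `v_p(Lη(0)) = v_p(L(W,1)/Ω_W)`, hence `g(0) ≠ 0`; §2 (B. D. Kim's formula
without the main conjecture) gives `v_p(g(0)) = ord_p #Sel + ord_p(Tam/#tors²) ≥ v_p(Lη(0))`; the
`Λ`-squeeze (§0) gives `(g) = (Lη)`. CONDITIONAL on the displayed inputs; nothing booked; `BSD(W,p)` is
an INPUT here, not a claim. [cite: Kobayashi2003, §4 Even main conjecture and Thm. 4.1 (p. 8), Thm. 9.3 with (9.33) (pp. 26–27), (3.6) (p. 7)]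
[cite: GreenbergLNM1716, §4 Thm. 4.1 and Lemma 4.2] [cite: BDKim2013, Thm. 1.1 (shape)]
[cite: KitajimaOtsuki2018, Main Thm. 1.3] [cite: Washington1997, §7.1, §13.2] -/
theorem quadraticBranchPlusEtaLowerInclusionAt_of_selmer_le
    (hPT : poitouTate_selmerStructure_duality_real ℚ) (hmod : hasEntireLFunction_rat)
    (h22 : Kobayashi2003.thm22_etaSignedSelmerDual_finite_torsion)
    (hKO : KitajimaOtsuki2018.mainThm13_etaSignedSelmerDual_noFiniteSubmodule)
    (V : WeierstrassCurve ℚ) [V.IsElliptic] [V.IsGloballyMinimal] (C : VariableChange ℚ)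
    (hp5 : 5 ≤ p) (hCV : C • W.quadraticTwist ((-1) ^ (p / 2) * p) = V)
    (hgood : V.HasGoodReductionAtPrime p) (hap : V.frobeniusTrace p = 0)
    (hup : ∀ (K₀ : Type) [Field K₀] [NumberField K₀] [IsCyclotomicExtension {p} ℚ K₀]
        [(galRange (K := ℚ) K₀).Normal] (ηq : absoluteGaloisGroup ℚ →* ℤˣ),
        (∀ σ ∈ galRange (K := ℚ) K₀, ηq σ = 1) → ηq ≠ 1 →
      ∀ {N : ℕ} [NeZero N] {f : CuspForm (Gamma0 N) 2},
        p ≠ 2 → V.HasGoodReductionAtPrime p → V.frobeniusTrace p = 0 → IsNewformOf V f →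
      ∀ (ϖ : ℚ), (if Even (p / 2) then (ϖ : ℝ) * V.realPeriodRat = plusPeriod f
          else (ϖ : ℝ) * V.imaginaryPeriodRat = minusPeriod f) →
      ∀ (Lη : IwasawaAlgebra p), IsQuadraticBranchPlusLFunction f p ϖ Lη →
      ∀ (κ : ZpExtension ℚ p) (γ : absoluteGaloisGroup ℚ),
        κ.IsCyclotomic → κ.IsTopGenerator γ → γ ∈ galRange (K := ℚ) K₀ → IsCyclotomicVariable p γ →
      ∀ (D : EtaSignedSelmerDualData V κ K₀ ℚ_[p] ηq γ 1), Ideal.span {Lη} ≤ D.charIdeal)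
    (hLW : W.entireLFunction 1 ≠ 0)
    (hle : ∀ q : ℚ, W.entireLFunction 1 / (W.realPeriodRat : ℂ) = (q : ℂ) →
      padicValRat p q ≤ (padicValNat p (Nat.card ↥(W.selmerGroupPInfty p)) : ℤ) +
        padicValRat p ((W.tamagawaProduct : ℚ) / (W.torsionOrder : ℚ) ^ 2)) :
    QuadraticBranchPlusEtaLowerInclusionAt V p := by
  intro K₀ _ _ _ _ ηq hηK hη1 N _ f hp2 hgoodV hapV hf ϖ hϖ Lη hL κ γ hκ hγ hγK hγc D'
  -- the dictionary data at the abstract `K₀ = ℚ(μ_p)`: `θ² = p*`, `ηq` = the sign character of `θ`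
  obtain ⟨θ, hθ2⟩ := exists_sq_eq_pStar p K₀ hp2
  have hc : θ ^ 2 = algebraMap ℚ K₀ ((-1) ^ (p / 2) * p) := by
    rw [hθ2, map_mul, map_pow, map_neg, map_one, map_natCast]
  have hθ : θ ∉ Set.range (algebraMap ℚ K₀) := by
    rintro ⟨q, hq⟩
    apply forall_sq_ne_pStar p q
    apply (algebraMap ℚ K₀).injective
    rw [map_pow, hq, hc]
  have hη := eta_eq_one_iff_smul_rootInClosure p K₀ hθ hc ηq hηK hη1
  have hDloc := localTowerHyp_padic p κ K₀ hκ
  have hκ₀ := kappa_surjOn_galRange_cyclotomic κ K₀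
  have hcop := coprime_index_galRange_cyclotomic p K₀
  -- §1: the plus dual datum of `W` over `ℚ_∞` with the SAME module
  obtain ⟨D, hfin, htor, hchar, hnf⟩ :=
    exists_strictSignedSelmerDualData_one_of_eta W K₀ hθ hc p κ hCV ηq hη ℚ_[p] hDloc hκ₀ hcop hγK D'
  -- Thm. 2.2 at `η` (finiteness / torsion) and Kitajima–Otsuki at `η` (no finite submodule), on `D'`
  obtain ⟨hfin', htor'⟩ :=
    EtaSignedSelmerDualData.finite_isTorsion_of_thm22 h22 hηK hp2 hgood hap hκ hγ hγK D'
  have hnf' : ∀ M : Submodule (IwasawaAlgebra p) D'.X, Finite M → M = ⊥ :=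
    hKO p K₀ ηq hηK V hp2 hgood hap κ γ hκ hγ hγK 1 D'.toLiterature hfin' htor'
  haveI : Module.Finite (IwasawaAlgebra p) D.X := hfin.mpr hfin'
  -- a generator of `Char(X⁺(V/K_∞)^η)` (`Λ` is a UFD: characteristic ideals are principal)
  haveI : D'.charIdeal.IsPrincipal := charIdeal_isPrincipal_holds p D'.X
  obtain ⟨g, hg⟩ := Submodule.IsPrincipal.principal D'.charIdeal
  have hg' : D'.charIdeal = Ideal.span {g} := hg
  have hgD : D.charIdeal = Ideal.span {g} := hchar.trans hg'
  -- the Kato side: `g ∣ Lη`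
  have hdvd : g ∣ Lη := by
    have h := hup K₀ ηq hηK hη1 hp2 hgood hap hf ϖ hϖ Lη hL κ γ hκ hγ hγK hγc D'
    rw [hg', Ideal.span_singleton_le_span_singleton] at h
    exact h
  -- the value identity: `v_p(Lη(0)) = v_p(L(W,1)/Ω_W)`, `Lη(0) ≠ 0`
  obtain ⟨q, hq⟩ :=
    EvenControlZero.exists_rat_entireLFunction_one_div_of_twist W p hmod hp2 V C hCV hgood hf hϖ
  obtain ⟨hval, h0L⟩ :=
    valuation_constantCoeff_eq_padicValRat_of_twist p hmod hp2 W V C hCV hgood hf hϖ hL hq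
  have hL0 : PowerSeries.constantCoeff Lη ≠ 0 := h0L hLW
  have hg0 : PowerSeries.constantCoeff g ≠ 0 := by
    obtain ⟨k, hk⟩ := hdvd
    intro h0
    apply hL0
    rw [hk, map_mul, h0, zero_mul]
  -- §2: B. D. Kim's formula for the generator `g` (no main conjecture)
  obtain ⟨-, hcount⟩ := finite_and_padicValNat_card_selmerGroupPInfty_add_eq_of_charIdeal_eq W p hPT
    V C hp5 hCV hgood hap hκ hγ D (htor.mpr htor') (hnf.mpr hnf') hgD hg0
  -- the squeeze
  have hvle : ((PowerSeries.constantCoeff Lη : ℤ_[p]) : ℚ_[p]).valuation ≤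
      ((PowerSeries.constantCoeff g : ℤ_[p]) : ℚ_[p]).valuation := by
    rw [hval, ← hcount]
    exact hle q hq
  have hspan : Ideal.span {g} = Ideal.span {Lη} := span_singleton_eq_of_dvd_of_valuation_le hdvd hL0 hvle
  rw [hg']
  exact hspan.le

/-- **THE CONVERSE ROAD in Miller's currency: the LOWER half of `BSD_p(W)` in analytic rank `0` ⟹
(E⁺_η)(V).** Same as `quadraticBranchPlusEtaLowerInclusionAt_of_selmer_le` with the Selmer-side
inequality supplied by `Typed.MissingLowerBoundAt W p` (`ord_p #Ш(W)_an ≤ ord_p #Ш(W)`) + GZK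
(`padicValRat_le_selmer_of_missingLowerBoundAt_rankZero`). So on a Gss2 rank-`0` row, ANY proof of the
lower `p`-part of BSD for the additive curve `W` (e.g. a unit Kurihara number through Kim's theorem)
IS a proof of Kobayashi's Eisenstein inclusion at `η` for its good supersingular twin `V` — granted the
displayed published inputs. CONDITIONAL; nothing booked.
[cite: Kobayashi2003, §4 (p. 8), Thm. 9.3 (p. 26), (3.6) (p. 7)] [cite: Miller2011LMS, Def. 1.1]
[cite: BDKim2013, Thm. 1.1 (shape)] [cite: KitajimaOtsuki2018, Main Thm. 1.3] -/
theorem quadraticBranchPlusEtaLowerInclusionAt_of_missingLowerBoundAt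
    (hPT : poitouTate_selmerStructure_duality_real ℚ) (hmod : hasEntireLFunction_rat)
    (hGZK : rank_eq_analyticRank_of_analyticRank_le_one)
    (h22 : Kobayashi2003.thm22_etaSignedSelmerDual_finite_torsion)
    (hKO : KitajimaOtsuki2018.mainThm13_etaSignedSelmerDual_noFiniteSubmodule)
    (V : WeierstrassCurve ℚ) [V.IsElliptic] [V.IsGloballyMinimal] (C : VariableChange ℚ)
    (hp5 : 5 ≤ p) (hCV : C • W.quadraticTwist ((-1) ^ (p / 2) * p) = V)
    (hgood : V.HasGoodReductionAtPrime p) (hap : V.frobeniusTrace p = 0)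
    (hup : ∀ (K₀ : Type) [Field K₀] [NumberField K₀] [IsCyclotomicExtension {p} ℚ K₀]
        [(galRange (K := ℚ) K₀).Normal] (ηq : absoluteGaloisGroup ℚ →* ℤˣ),
        (∀ σ ∈ galRange (K := ℚ) K₀, ηq σ = 1) → ηq ≠ 1 →
      ∀ {N : ℕ} [NeZero N] {f : CuspForm (Gamma0 N) 2},
        p ≠ 2 → V.HasGoodReductionAtPrime p → V.frobeniusTrace p = 0 → IsNewformOf V f →
      ∀ (ϖ : ℚ), (if Even (p / 2) then (ϖ : ℝ) * V.realPeriodRat = plusPeriod f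
          else (ϖ : ℝ) * V.imaginaryPeriodRat = minusPeriod f) →
      ∀ (Lη : IwasawaAlgebra p), IsQuadraticBranchPlusLFunction f p ϖ Lη →
      ∀ (κ : ZpExtension ℚ p) (γ : absoluteGaloisGroup ℚ),
        κ.IsCyclotomic → κ.IsTopGenerator γ → γ ∈ galRange (K := ℚ) K₀ → IsCyclotomicVariable p γ →
      ∀ (D : EtaSignedSelmerDualData V κ K₀ ℚ_[p] ηq γ 1), Ideal.span {Lη} ≤ D.charIdeal)
    (hLW : W.entireLFunction 1 ≠ 0) (hlow : MissingLowerBoundAt W p) :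
    QuadraticBranchPlusEtaLowerInclusionAt V p :=
  quadraticBranchPlusEtaLowerInclusionAt_of_selmer_le W p hPT hmod h22 hKO V C hp5 hCV hgood hap hup hLW
    fun _ hq ↦ padicValRat_le_selmer_of_missingLowerBoundAt_rankZero W p hGZK hLW hq hlow

/-- **THE CONVERSE ROAD ON THE TOWER-ONTO LOCUS (the rows of crux 19601 `PlusEtaLowerInclusion`):
lower half of `BSD_p(W)` in analytic rank `0` + Kobayashi's Thm. 4.1 at `η` ⟹ (E⁺_η)(V).** With
`ρ_{V,p^m}` onto for every `m`, the Kato-side inclusion `hup` of the previous theorems is Kobayashi's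
Thm. 4.1 at `η` with `n = 0` (named fact `thm41_plusEtaCharIdeal_dvd`, through
`EtaSignedSelmerDualData.thm41_plus_of_facts`). INPUTS: `hPT`, `hmod`, GZK, Thm. 2.2 at `η`, Thm. 4.1
at `η`, Kitajima–Otsuki 1.3 at `η` (named facts, hypothesis position), `L(W,1) ≠ 0`,
`Typed.MissingLowerBoundAt W p`. CONDITIONAL; closes nothing class-wide (the lower half of `BSD_p` on
the Gss2 rank-`0` rows is itself open class-wide: it is what this road CONSUMES).
[cite: Kobayashi2003, Thm. 4.1 (p. 8, last sentence: n = 0 for surjective ρ), §4 Even main conjecture]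
[cite: Kato2004Asterisque, Thm. 12.5] [cite: Miller2011LMS, Def. 1.1] -/
theorem quadraticBranchPlusEtaLowerInclusionAt_of_missingLowerBoundAt_of_surjective
    (hPT : poitouTate_selmerStructure_duality_real ℚ) (hmod : hasEntireLFunction_rat)
    (hGZK : rank_eq_analyticRank_of_analyticRank_le_one)
    (h22 : Kobayashi2003.thm22_etaSignedSelmerDual_finite_torsion)
    (h41 : Kobayashi2003.thm41_plusEtaCharIdeal_dvd)
    (hKO : KitajimaOtsuki2018.mainThm13_etaSignedSelmerDual_noFiniteSubmodule)
    (V : WeierstrassCurve ℚ) [V.IsElliptic] [V.IsGloballyMinimal] (C : VariableChange ℚ)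
    (hp5 : 5 ≤ p) (hCV : C • W.quadraticTwist ((-1) ^ (p / 2) * p) = V)
    (hgood : V.HasGoodReductionAtPrime p) (hap : V.frobeniusTrace p = 0)
    (hsurj : ∀ m : ℕ, V.HasSurjectiveModNGaloisRep (p ^ m : ℕ))
    (hLW : W.entireLFunction 1 ≠ 0) (hlow : MissingLowerBoundAt W p) :
    QuadraticBranchPlusEtaLowerInclusionAt V p :=
  quadraticBranchPlusEtaLowerInclusionAt_of_missingLowerBoundAt W p hPT hmod hGZK h22 hKO V C hp5 hCV hgood
    hap (fun _ _ _ _ _ _ hηK hη1 _ _ _ hp2 hgood' hap' hf ϖ hϖ Lη hL _ _ hκ hγ hγK hγc D ↦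
      (EtaSignedSelmerDualData.thm41_plus_of_facts h22 h41 hηK hη1 hp2 hgood' hap' hf ϖ hϖ Lη hL hκ hγ
        hγK hγc D).2 hsurj) hLW hlow

/-- **Kobayashi's EVEN MAIN CONJECTURE AT `η`, IN FULL, at a tower-onto Gss2 rank-`0` pair from the
lower half of `BSD_p(W)`** (`QuadraticBranchPlusEtaMainConjectureAt V p`: `X⁺(V/K_∞)^η` finitely
generated torsion and `Char(X⁺(V/K_∞)^η) = (L_p⁺(V, η, X))` for every datum): the Eisenstein half is
the previous theorem, the Kato half is Thm. 4.1 at `η` (`n = 0`), finiteness is Thm. 2.2 at `η`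
(`quadraticBranchPlusEtaMainConjectureAt_of_facts_of_surjective_of_etaLowerInclusion`). CONDITIONAL on
the displayed named facts + `L(W,1) ≠ 0` + `Typed.MissingLowerBoundAt W p`; nothing booked.
[cite: Kobayashi2003, §4 Even main conjecture and Thm. 4.1 (p. 8), Thm. 2.2 (p. 5)] -/
theorem quadraticBranchPlusEtaMainConjectureAt_of_missingLowerBoundAt_of_surjective
    (hPT : poitouTate_selmerStructure_duality_real ℚ) (hmod : hasEntireLFunction_rat)
    (hGZK : rank_eq_analyticRank_of_analyticRank_le_one)
    (h22 : Kobayashi2003.thm22_etaSignedSelmerDual_finite_torsion)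
    (h41 : Kobayashi2003.thm41_plusEtaCharIdeal_dvd)
    (hKO : KitajimaOtsuki2018.mainThm13_etaSignedSelmerDual_noFiniteSubmodule)
    (V : WeierstrassCurve ℚ) [V.IsElliptic] [V.IsGloballyMinimal] (C : VariableChange ℚ)
    (hp5 : 5 ≤ p) (hCV : C • W.quadraticTwist ((-1) ^ (p / 2) * p) = V)
    (hgood : V.HasGoodReductionAtPrime p) (hap : V.frobeniusTrace p = 0)
    (hsurj : ∀ m : ℕ, V.HasSurjectiveModNGaloisRep (p ^ m : ℕ))
    (hLW : W.entireLFunction 1 ≠ 0) (hlow : MissingLowerBoundAt W p) :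
    QuadraticBranchPlusEtaMainConjectureAt V p :=
  quadraticBranchPlusEtaMainConjectureAt_of_facts_of_surjective_of_etaLowerInclusion h22 h41 hsurj
    (quadraticBranchPlusEtaLowerInclusionAt_of_missingLowerBoundAt_of_surjective W p hPT hmod hGZK h22
      h41 hKO V C hp5 hCV hgood hap hsurj hLW hlow)

/-- **`BSD_p(W)` ⟹ (E⁺_η)(V)** on a tower-onto Gss2 rank-`0` pair (`W.analyticRank = 0`): Miller's
`BSD(W, p)` contains the lower half (`missingPPartAt_of_bsdp`, `lower_and_upper_of_missingPPartAt`;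
`Ш(W)` finite by GZK). CONDITIONAL on the displayed named facts; nothing booked.
[cite: Miller2011LMS, Def. 1.1] [cite: Kobayashi2003, §4 (p. 8)] -/
theorem quadraticBranchPlusEtaLowerInclusionAt_of_bsdp_of_surjective
    (hPT : poitouTate_selmerStructure_duality_real ℚ) (hmod : hasEntireLFunction_rat)
    (hGZK : rank_eq_analyticRank_of_analyticRank_le_one)
    (h22 : Kobayashi2003.thm22_etaSignedSelmerDual_finite_torsion)
    (h41 : Kobayashi2003.thm41_plusEtaCharIdeal_dvd)
    (hKO : KitajimaOtsuki2018.mainThm13_etaSignedSelmerDual_noFiniteSubmodule)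
    (V : WeierstrassCurve ℚ) [V.IsElliptic] [V.IsGloballyMinimal] (C : VariableChange ℚ)
    (hp5 : 5 ≤ p) (hCV : C • W.quadraticTwist ((-1) ^ (p / 2) * p) = V)
    (hgood : V.HasGoodReductionAtPrime p) (hap : V.frobeniusTrace p = 0)
    (hsurj : ∀ m : ℕ, V.HasSurjectiveModNGaloisRep (p ^ m : ℕ))
    (hr : W.analyticRank = 0) (hbsd : BSDp W p) :
    QuadraticBranchPlusEtaLowerInclusionAt V p := by
  obtain ⟨-, hfin⟩ := hGZK W (by rw [hr]; exact zero_le_one)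
  haveI : Finite W.sha := hfin
  have hLW : W.entireLFunction 1 ≠ 0 := (W.analyticRank_eq_zero_iff_holds (hmod W)).mp hr
  exact quadraticBranchPlusEtaLowerInclusionAt_of_missingLowerBoundAt_of_surjective W p hPT hmod hGZK h22
    h41 hKO V C hp5 hCV hgood hap hsurj hLW
    (lower_and_upper_of_missingPPartAt W p (missingPPartAt_of_bsdp W p hbsd)).1

/-- **(E⁺_η)(V) on a tower-onto rank-`0` row whose ANALYTIC SHA has non-positive `p`-adic valuation
— Tamagawa numbers regardless.** If `#Ш(W)_an = s ∈ ℚ` with `v_p(s) ≤ 0` then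
`Typed.MissingLowerBoundAt W p` holds trivially (`v_p(s) ≤ 0 ≤ ord_p #Ш(W)`), so the converse road
fires: e.g. the four Tamagawa-defect rows of 19601's census j255146 with `ord₅ #Ш_an = 0`,
`ord₅ Tam(W) = 2` (168150g1, 231650m1, 248550l1, 321450n1), where the Selmer-shape witness of p459681
(`v_p(L(W,1)/Ω_W) ≤ ord_p #Sel_{p^∞}(W/ℚ)`) would need `5² ∣ #Ш(W)[5^∞]`. The per-row analytic input is
then ONE exact rational number (`#Ш(W)_an`, modular symbols) — not a Kurihara number, not a descent.
CONDITIONAL on the named facts; nothing booked; no row is claimed here.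
[cite: Kobayashi2003, §4 Even main conjecture and Thm. 4.1 (p. 8)] [cite: Miller2011LMS, §1 and Def. 1.1] -/
theorem quadraticBranchPlusEtaLowerInclusionAt_of_shaAn_nonpos_of_surjective
    (hPT : poitouTate_selmerStructure_duality_real ℚ) (hmod : hasEntireLFunction_rat)
    (hGZK : rank_eq_analyticRank_of_analyticRank_le_one)
    (h22 : Kobayashi2003.thm22_etaSignedSelmerDual_finite_torsion)
    (h41 : Kobayashi2003.thm41_plusEtaCharIdeal_dvd)
    (hKO : KitajimaOtsuki2018.mainThm13_etaSignedSelmerDual_noFiniteSubmodule)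
    (V : WeierstrassCurve ℚ) [V.IsElliptic] [V.IsGloballyMinimal] (C : VariableChange ℚ)
    (hp5 : 5 ≤ p) (hCV : C • W.quadraticTwist ((-1) ^ (p / 2) * p) = V)
    (hgood : V.HasGoodReductionAtPrime p) (hap : V.frobeniusTrace p = 0)
    (hsurj : ∀ m : ℕ, V.HasSurjectiveModNGaloisRep (p ^ m : ℕ))
    (hLW : W.entireLFunction 1 ≠ 0) (hsha : ∃ s : ℚ, shaAn W = (s : ℂ) ∧ padicValRat p s ≤ 0) :
    QuadraticBranchPlusEtaLowerInclusionAt V p := by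
  obtain ⟨s, hs, hv⟩ := hsha
  exact quadraticBranchPlusEtaLowerInclusionAt_of_missingLowerBoundAt_of_surjective W p hPT hmod hGZK h22
    h41 hKO V C hp5 hCV hgood hap hsurj hLW ⟨s, hs, hv.trans (by positivity)⟩

/-- **Kobayashi's even main conjecture at `η` in full on a tower-onto rank-`0` row whose analytic Sha
has non-positive `p`-adic valuation** (Tamagawa numbers regardless). CONDITIONAL; nothing booked.
[cite: Kobayashi2003, §4 Even main conjecture and Thm. 4.1 (p. 8), Thm. 2.2 (p. 5)] -/
theorem quadraticBranchPlusEtaMainConjectureAt_of_shaAn_nonpos_of_surjective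
    (hPT : poitouTate_selmerStructure_duality_real ℚ) (hmod : hasEntireLFunction_rat)
    (hGZK : rank_eq_analyticRank_of_analyticRank_le_one)
    (h22 : Kobayashi2003.thm22_etaSignedSelmerDual_finite_torsion)
    (h41 : Kobayashi2003.thm41_plusEtaCharIdeal_dvd)
    (hKO : KitajimaOtsuki2018.mainThm13_etaSignedSelmerDual_noFiniteSubmodule)
    (V : WeierstrassCurve ℚ) [V.IsElliptic] [V.IsGloballyMinimal] (C : VariableChange ℚ)
    (hp5 : 5 ≤ p) (hCV : C • W.quadraticTwist ((-1) ^ (p / 2) * p) = V)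
    (hgood : V.HasGoodReductionAtPrime p) (hap : V.frobeniusTrace p = 0)
    (hsurj : ∀ m : ℕ, V.HasSurjectiveModNGaloisRep (p ^ m : ℕ))
    (hLW : W.entireLFunction 1 ≠ 0) (hsha : ∃ s : ℚ, shaAn W = (s : ℂ) ∧ padicValRat p s ≤ 0) :
    QuadraticBranchPlusEtaMainConjectureAt V p :=
  quadraticBranchPlusEtaMainConjectureAt_of_facts_of_surjective_of_etaLowerInclusion h22 h41 hsurj
    (quadraticBranchPlusEtaLowerInclusionAt_of_shaAn_nonpos_of_surjective W p hPT hmod hGZK h22 h41 hKO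
      V C hp5 hCV hgood hap hsurj hLW hsha)

end Converse

end ConverseControl

end Summit.BirchSwinnertonDyer.BirchSwinnertonDyer.Theorems

end
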